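import Literature.MathematicalPhysics.QuantumLattice.TorusWilsonMarkov
import Literature.Analysis.FluidPDE.EnergyToolkit
import HarnessLib

/-!
# Crux `IR` (stmt-QuantumFields-19354) — merged maxcorr line «maximal correlation at one physical thickness»:
support ENGINE (T1) «tensorisation of maximal correlation», part 1 — the two-block Fubini lemma (law form)

Helper module for item `stmt-QuantumFields-19354` (`--supports`; it closes nothing).  It serves the typed, so far
unproved support statement `Tensorisation.TensorisationEngine` of the merged line's workfile
`Cruxes/IR/Lines/tensorisation_engine.lean` (ideator ym-ir-idea-1, MECHANISM card §4; Witsenhausen, SIAM J. Appl. Math.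
28 (1975) Thm. 1; Kumar's lemma; Polyanskiy–Wu, *Information Theory* Thm. 33.6 (d)): the Hirschfeld–Gebelein–Rényi maximal
correlation of a pair of JOINS of independent pair-algebras is the maximum (not the sum) of the pair correlations.

This file is the analytic core, stated for LAWS (no σ-algebras, no conditional expectations): if `P` is a probability
measure on `E` and `Q` one on `F`, and bounded measurable `u v : E × F → ℝ` satisfy the covariance bound
`|Cov| ≤ ρ σ σ` (a) under `Q` along every `E`-section and (b) under `P` after averaging the `F`-variable out, then they
satisfy it under `P ⊗ Q` (`two_block`).  Proof: Fubini, the law of total variance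
`Var_{P⊗Q} u = ∫ Var_Q u(e,·) dP + Var_P (∫ u(e,·) dQ)`, Cauchy–Schwarz in `L²(P)` (tree lemma
`Literature.Analysis.FluidPDE.integral_mul_le_sqrt_mul_sqrt_of_memLp`) and the two-dimensional Cauchy–Schwarz
inequality `xy + zw ≤ √(x²+z²) √(y²+w²)` — the «conditional» proof of tensorisation, which avoids the singular-value
decomposition of the original.
Part 2 (`…ShellMaxCorrTensorisation.lean`) transports this to sub-σ-algebras of one probability space, runs the
induction over finitely many independent pairs, and converts to the operator format of the workfile.

HONEST FRAMING: abstract probability (a group-blind support engine of a CONDITIONAL rung line); it proves nothing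
about Yang–Mills.  `BalabanLadder.IR` is NOT proved; the Clay YM mass gap is NOT proved; R4 closes only the
conditional finite-𝕋⁴ rung `BalabanLadder.UV`.
-/

set_option autoImplicit false

noncomputable section

open MeasureTheory ProbabilityTheory

namespace Summit.QuantumFields.YangMills.Cruxes.IR.ShellMaxCorr.Tensorisation

/-! ## §1 Elementary inequalities and integrability of bounded statistics -/

section Bounded

variable {α : Type*} [MeasurableSpace α] {μ : Measure α}

/-- A bounded measurable real function on a finite measure space is integrable. -/
theorem integrable_of_bdd [IsFiniteMeasure μ] {f : α → ℝ} (hf : Measurable f) {M : ℝ}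
    (hM : ∀ x, |f x| ≤ M) : Integrable f μ :=
  Integrable.of_bound hf.aestronglyMeasurable M (ae_of_all _ fun x => by rw [Real.norm_eq_abs]; exact hM x)

/-- On a probability space, `|∫ f| ≤ |M|` if `|f| ≤ M` pointwise. -/
theorem abs_integral_le_abs_of_bdd [IsProbabilityMeasure μ] {f : α → ℝ} {M : ℝ}
    (hM : ∀ x, |f x| ≤ M) : |∫ x, f x ∂μ| ≤ |M| := by
  refine (abs_integral_le_integral_abs).trans ?_
  refine (integral_mono_of_nonneg (ae_of_all _ fun x => abs_nonneg _) (integrable_const |M|)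
    (ae_of_all _ fun x => (hM x).trans (le_abs_self M))).trans ?_
  simp

/-- `∫ (g − c)² = ∫ g² − 2 c ∫ g + c²` on a probability space, for bounded measurable `g`. -/
theorem integral_sub_const_sq [IsProbabilityMeasure μ] {g : α → ℝ} (hg : Measurable g) {M : ℝ}
    (hM : ∀ x, |g x| ≤ M) (c : ℝ) :
    ∫ x, (g x - c) ^ 2 ∂μ = (∫ x, g x ^ 2 ∂μ) - 2 * c * (∫ x, g x ∂μ) + c ^ 2 := by
  have hgi : Integrable g μ := integrable_of_bdd hg hM
  have hg2 : Integrable (fun x => g x ^ 2) μ := by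
    refine integrable_of_bdd (hg.pow_const 2) (M := M ^ 2) fun x => ?_
    rw [abs_pow]; exact pow_le_pow_left₀ (abs_nonneg _) (hM x) 2
  have hexp : (fun x => (g x - c) ^ 2) = fun x => g x ^ 2 - 2 * c * g x + c ^ 2 := by
    funext x; ring
  have h1 : ∫ x, (g x ^ 2 - 2 * c * g x + c ^ 2) ∂μ = (∫ x, (g x ^ 2 - 2 * c * g x) ∂μ) + ∫ _x, c ^ 2 ∂μ :=
    integral_add (hg2.sub (hgi.const_mul _)) (integrable_const _)
  have h2 : ∫ x, (g x ^ 2 - 2 * c * g x) ∂μ = (∫ x, g x ^ 2 ∂μ) - ∫ x, 2 * c * g x ∂μ :=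
    integral_sub hg2 (hgi.const_mul _)
  rw [hexp, h1, h2, integral_const_mul]
  simp

/-- **Variance about an arbitrary centre**: `∫ (g − c)² = ∫ (g − ∫ g)² + (∫ g − c)²` on a probability space. -/
theorem integral_sub_sq_eq_var_add [IsProbabilityMeasure μ] {g : α → ℝ} (hg : Measurable g) {M : ℝ}
    (hM : ∀ x, |g x| ≤ M) (c : ℝ) :
    ∫ x, (g x - c) ^ 2 ∂μ = (∫ x, (g x - ∫ x', g x' ∂μ) ^ 2 ∂μ) + ((∫ x, g x ∂μ) - c) ^ 2 := by
  rw [integral_sub_const_sq hg hM c, integral_sub_const_sq hg hM (∫ x', g x' ∂μ)]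
  ring

end Bounded

/-! ## §2 The two-block lemma (Fubini form of tensorisation) -/

section TwoBlock

variable {E F : Type*} [MeasurableSpace E] [MeasurableSpace F]
  {P : Measure E} {Q : Measure F} [IsProbabilityMeasure P] [IsProbabilityMeasure Q]

/-- Sections of a bounded measurable `u : E × F → ℝ` are bounded measurable. -/
theorem measurable_section {u : E × F → ℝ} (hu : Measurable u) (e : E) : Measurable fun f => u (e, f) :=
  hu.comp measurable_prodMk_left

/-- The section average `e ↦ ∫ u(e,f) dQ(f)` is measurable. -/
theorem measurable_sectionAvg {u : E × F → ℝ} (hu : Measurable u) :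
    Measurable fun e => ∫ f, u (e, f) ∂Q :=
  (hu.stronglyMeasurable.integral_prod_right' (ν := Q)).measurable

omit [MeasurableSpace E] in
/-- The section average is bounded by `|M|`. -/
theorem abs_sectionAvg_le {u : E × F → ℝ} {M : ℝ} (hM : ∀ p, |u p| ≤ M) (e : E) :
    |∫ f, u (e, f) ∂Q| ≤ |M| :=
  abs_integral_le_abs_of_bdd fun f => hM (e, f)

/-- The section variance `e ↦ ∫ (u(e,f) − ∫ u(e,·) dQ)² dQ(f)` is measurable. -/
theorem measurable_sectionVar {u : E × F → ℝ} (hu : Measurable u) :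
    Measurable fun e => ∫ f, (u (e, f) - ∫ f', u (e, f') ∂Q) ^ 2 ∂Q := by
  have hm : Measurable fun p : E × F => (u p - ∫ f', u (p.1, f') ∂Q) ^ 2 :=
    (hu.sub ((measurable_sectionAvg (Q := Q) hu).comp measurable_fst)).pow_const 2
  exact (hm.stronglyMeasurable.integral_prod_right' (ν := Q)).measurable

omit [MeasurableSpace E] in
/-- The section variance is at most `(|M| + |M|)²`. -/
theorem sectionVar_le {u : E × F → ℝ} {M : ℝ} (hM : ∀ p, |u p| ≤ M) (e : E) :
    ∫ f, (u (e, f) - ∫ f', u (e, f') ∂Q) ^ 2 ∂Q ≤ (|M| + |M|) ^ 2 := by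
  have hpt : ∀ f, (u (e, f) - ∫ f', u (e, f') ∂Q) ^ 2 ≤ (|M| + |M|) ^ 2 := fun f => by
    rw [← sq_abs]
    refine pow_le_pow_left₀ (abs_nonneg _) ((abs_sub _ _).trans (add_le_add ?_ ?_)) 2
    · exact (hM (e, f)).trans (le_abs_self M)
    · exact abs_sectionAvg_le hM e
  refine (integral_mono_of_nonneg (ae_of_all _ fun f => sq_nonneg _) (integrable_const _)
    (ae_of_all _ hpt)).trans ?_
  simp

omit [MeasurableSpace E] [IsProbabilityMeasure Q] in
/-- The section variance is nonnegative. -/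
theorem sectionVar_nonneg {u : E × F → ℝ} (e : E) :
    0 ≤ ∫ f, (u (e, f) - ∫ f', u (e, f') ∂Q) ^ 2 ∂Q :=
  integral_nonneg fun _ => sq_nonneg _

/-- **Law of total variance** for a bounded measurable `u : E × F → ℝ` under `P ⊗ Q`:
`∫ (u − c)² d(P⊗Q) = ∫ Var_Q u(e,·) dP(e) + ∫ (∫ u(e,·) dQ − c)² dP(e)` for every centre `c`. -/
theorem integral_prod_sub_sq {u : E × F → ℝ} (hu : Measurable u) {M : ℝ} (hM : ∀ p, |u p| ≤ M) (c : ℝ) :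
    ∫ p, (u p - c) ^ 2 ∂(P.prod Q) =
      (∫ e, ∫ f, (u (e, f) - ∫ f', u (e, f') ∂Q) ^ 2 ∂Q ∂P) + ∫ e, ((∫ f, u (e, f) ∂Q) - c) ^ 2 ∂P := by
  have hint : Integrable (fun p : E × F => (u p - c) ^ 2) (P.prod Q) := by
    refine integrable_of_bdd ((hu.sub measurable_const).pow_const 2) (M := (|M| + |c|) ^ 2) fun p => ?_
    rw [abs_pow]
    exact pow_le_pow_left₀ (abs_nonneg _) ((abs_sub _ _).trans
      (add_le_add ((hM p).trans (le_abs_self M)) le_rfl)) 2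
  rw [integral_prod _ hint]
  have hpt : ∀ e, ∫ f, (u (e, f) - c) ^ 2 ∂Q =
      (∫ f, (u (e, f) - ∫ f', u (e, f') ∂Q) ^ 2 ∂Q) + ((∫ f, u (e, f) ∂Q) - c) ^ 2 := fun e =>
    integral_sub_sq_eq_var_add (measurable_section hu e) (fun f => hM (e, f)) c
  simp_rw [hpt]
  have h1 : Integrable (fun e => ∫ f, (u (e, f) - ∫ f', u (e, f') ∂Q) ^ 2 ∂Q) P := by
    refine integrable_of_bdd (measurable_sectionVar hu) (M := (|M| + |M|) ^ 2) fun e => ?_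
    rw [abs_of_nonneg (sectionVar_nonneg e)]
    exact sectionVar_le hM e
  have h2 : Integrable (fun e => ((∫ f, u (e, f) ∂Q) - c) ^ 2) P := by
    refine integrable_of_bdd (((measurable_sectionAvg hu).sub measurable_const).pow_const 2)
      (M := (|M| + |c|) ^ 2) fun e => ?_
    rw [abs_pow]
    exact pow_le_pow_left₀ (abs_nonneg _) ((abs_sub _ _).trans
      (add_le_add (abs_sectionAvg_le hM e) le_rfl)) 2
  exact integral_add h1 h2

/-- Fubini for the mean of a bounded measurable `u` under `P ⊗ Q`. -/
theorem integral_prod_eq_sectionAvg {u : E × F → ℝ} (hu : Measurable u) {M : ℝ} (hM : ∀ p, |u p| ≤ M) :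
    ∫ p, u p ∂(P.prod Q) = ∫ e, ∫ f, u (e, f) ∂Q ∂P :=
  integral_prod _ (integrable_of_bdd hu hM)

/-- **Two-block lemma (tensorisation of maximal correlation, Fubini form).**  Let `u, v : E × F → ℝ` be bounded
measurable.  If (a) along every section `e` the pair `(u(e,·), v(e,·))` satisfies `|Cov_Q| ≤ ρ σ_Q σ_Q`, and (b) the
section averages `(∫ u(e,·) dQ, ∫ v(e,·) dQ)` satisfy `|Cov_P| ≤ ρ σ_P σ_P`, then `|Cov_{P⊗Q}(u,v)| ≤ ρ σ(u) σ(v)`.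
(Witsenhausen 1975, Thm. 1, in the conditional form: total variance + two-dimensional Cauchy–Schwarz.) -/
theorem two_block {ρ : ℝ} (hρ : 0 ≤ ρ) {u v : E × F → ℝ} (hu : Measurable u) (hv : Measurable v)
    {Mu Mv : ℝ} (hMu : ∀ p, |u p| ≤ Mu) (hMv : ∀ p, |v p| ≤ Mv)
    (h2 : ∀ e : E,
      |(∫ f, u (e, f) * v (e, f) ∂Q) - (∫ f, u (e, f) ∂Q) * (∫ f, v (e, f) ∂Q)| ≤
        ρ * Real.sqrt (∫ f, (u (e, f) - ∫ f', u (e, f') ∂Q) ^ 2 ∂Q)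
          * Real.sqrt (∫ f, (v (e, f) - ∫ f', v (e, f') ∂Q) ^ 2 ∂Q))
    (h1 : |(∫ e, (∫ f, u (e, f) ∂Q) * (∫ f, v (e, f) ∂Q) ∂P)
            - (∫ e, ∫ f, u (e, f) ∂Q ∂P) * (∫ e, ∫ f, v (e, f) ∂Q ∂P)| ≤
        ρ * Real.sqrt (∫ e, ((∫ f, u (e, f) ∂Q) - ∫ e', ∫ f, u (e', f) ∂Q ∂P) ^ 2 ∂P)
          * Real.sqrt (∫ e, ((∫ f, v (e, f) ∂Q) - ∫ e', ∫ f, v (e', f) ∂Q ∂P) ^ 2 ∂P)) :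
    |(∫ p, u p * v p ∂(P.prod Q)) - (∫ p, u p ∂(P.prod Q)) * (∫ p, v p ∂(P.prod Q))| ≤
      ρ * Real.sqrt (∫ p, (u p - ∫ p', u p' ∂(P.prod Q)) ^ 2 ∂(P.prod Q))
        * Real.sqrt (∫ p, (v p - ∫ p', v p' ∂(P.prod Q)) ^ 2 ∂(P.prod Q)) := by
  -- two-dimensional Cauchy–Schwarz `x y + z w ≤ √(x²+z²) √(y²+w²)`
  have cs2 : ∀ x y z w : ℝ, x * y + z * w ≤ Real.sqrt (x ^ 2 + z ^ 2) * Real.sqrt (y ^ 2 + w ^ 2) := by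
    intro x y z w
    rw [← Real.sqrt_mul (by positivity)]
    exact (le_abs_self _).trans (Real.abs_le_sqrt (by nlinarith [sq_nonneg (x * w - z * y)]))
  -- notation
  set a : E → ℝ := fun e => ∫ f, u (e, f) ∂Q with ha_def
  set b : E → ℝ := fun e => ∫ f, v (e, f) ∂Q with hb_def
  set su : E → ℝ := fun e => Real.sqrt (∫ f, (u (e, f) - ∫ f', u (e, f') ∂Q) ^ 2 ∂Q) with hsu_def
  set sv : E → ℝ := fun e => Real.sqrt (∫ f, (v (e, f) - ∫ f', v (e, f') ∂Q) ^ 2 ∂Q) with hsv_def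
  have ha : Measurable a := measurable_sectionAvg hu
  have hb : Measurable b := measurable_sectionAvg hv
  have haM : ∀ e, |a e| ≤ |Mu| := abs_sectionAvg_le hMu
  have hbM : ∀ e, |b e| ≤ |Mv| := abs_sectionAvg_le hMv
  have hsu : Measurable su := Real.continuous_sqrt.measurable.comp (measurable_sectionVar hu)
  have hsv : Measurable sv := Real.continuous_sqrt.measurable.comp (measurable_sectionVar hv)
  have hsu0 : ∀ e, 0 ≤ su e := fun e => Real.sqrt_nonneg _
  have hsv0 : ∀ e, 0 ≤ sv e := fun e => Real.sqrt_nonneg _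
  have hsuM : ∀ e, |su e| ≤ |Mu| + |Mu| := fun e => by
    rw [abs_of_nonneg (hsu0 e)]
    calc su e ≤ Real.sqrt ((|Mu| + |Mu|) ^ 2) := Real.sqrt_le_sqrt (sectionVar_le hMu e)
      _ = |Mu| + |Mu| := Real.sqrt_sq (by positivity)
  have hsvM : ∀ e, |sv e| ≤ |Mv| + |Mv| := fun e => by
    rw [abs_of_nonneg (hsv0 e)]
    calc sv e ≤ Real.sqrt ((|Mv| + |Mv|) ^ 2) := Real.sqrt_le_sqrt (sectionVar_le hMv e)
      _ = |Mv| + |Mv| := Real.sqrt_sq (by positivity)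
  -- means
  set mu : ℝ := ∫ p, u p ∂(P.prod Q) with hmu_def
  set mv : ℝ := ∫ p, v p ∂(P.prod Q) with hmv_def
  have hmu : mu = ∫ e, a e ∂P := integral_prod_eq_sectionAvg hu hMu
  have hmv : mv = ∫ e, b e ∂P := integral_prod_eq_sectionAvg hv hMv
  -- Step 1: Fubini for `∫ u v`
  have huv : Measurable fun p : E × F => u p * v p := hu.mul hv
  have huvM : ∀ p, |u p * v p| ≤ |Mu| * |Mv| := fun p => by
    rw [abs_mul]
    exact mul_le_mul ((hMu p).trans (le_abs_self _)) ((hMv p).trans (le_abs_self _))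
      (abs_nonneg _) (abs_nonneg _)
  have hF : ∫ p, u p * v p ∂(P.prod Q) = ∫ e, ∫ f, u (e, f) * v (e, f) ∂Q ∂P :=
    integral_prod_eq_sectionAvg huv huvM
  -- Step 2: the inner (section) bound, integrated
  have hinner_meas : Measurable fun e => ∫ f, u (e, f) * v (e, f) ∂Q := measurable_sectionAvg huv
  have hinner_bdd : ∀ e, |∫ f, u (e, f) * v (e, f) ∂Q| ≤ |(|Mu| * |Mv|)| := abs_sectionAvg_le huvM
  have hab_meas : Measurable fun e => a e * b e := ha.mul hb
  have hab_int : Integrable (fun e => a e * b e) P :=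
    integrable_of_bdd hab_meas (M := |Mu| * |Mv|) fun e => by
      show |a e * b e| ≤ _
      rw [abs_mul]; exact mul_le_mul (haM e) (hbM e) (abs_nonneg _) (abs_nonneg _)
  have hdiff_int : Integrable (fun e => (∫ f, u (e, f) * v (e, f) ∂Q) - a e * b e) P :=
    (integrable_of_bdd hinner_meas hinner_bdd).sub hab_int
  have hss_meas : Measurable fun e => su e * sv e := hsu.mul hsv
  have hsusv_int : Integrable (fun e => ρ * (su e * sv e)) P :=
    (integrable_of_bdd hss_meas (M := (|Mu| + |Mu|) * (|Mv| + |Mv|)) fun e => by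
      show |su e * sv e| ≤ _
      rw [abs_mul]; exact mul_le_mul (hsuM e) (hsvM e) (abs_nonneg _) (by positivity)).const_mul ρ
  have hstep2 : |(∫ e, ∫ f, u (e, f) * v (e, f) ∂Q ∂P) - ∫ e, a e * b e ∂P| ≤
      ρ * (Real.sqrt (∫ e, su e ^ 2 ∂P) * Real.sqrt (∫ e, sv e ^ 2 ∂P)) := by
    rw [← integral_sub (integrable_of_bdd hinner_meas hinner_bdd) hab_int]
    calc |∫ e, ((∫ f, u (e, f) * v (e, f) ∂Q) - a e * b e) ∂P|
        ≤ ∫ e, |(∫ f, u (e, f) * v (e, f) ∂Q) - a e * b e| ∂P := abs_integral_le_integral_abs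
      _ ≤ ∫ e, ρ * (su e * sv e) ∂P := by
          refine integral_mono hdiff_int.abs hsusv_int fun e => ?_
          have := h2 e
          rw [mul_assoc] at this
          exact this
      _ = ρ * ∫ e, su e * sv e ∂P := integral_const_mul _ _
      _ ≤ ρ * (Real.sqrt (∫ e, su e ^ 2 ∂P) * Real.sqrt (∫ e, sv e ^ 2 ∂P)) := by
          refine mul_le_mul_of_nonneg_left
            (Literature.Analysis.FluidPDE.integral_mul_le_sqrt_mul_sqrt_of_memLp ?_ ?_) hρ
          · exact MemLp.of_bound hsu.aestronglyMeasurable (|Mu| + |Mu|)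
              (ae_of_all _ fun e => by rw [Real.norm_eq_abs]; exact hsuM e)
          · exact MemLp.of_bound hsv.aestronglyMeasurable (|Mv| + |Mv|)
              (ae_of_all _ fun e => by rw [Real.norm_eq_abs]; exact hsvM e)
  -- Step 3: the outer bound is `h1`, rewritten in the notation
  have hstep3 : |(∫ e, a e * b e ∂P) - mu * mv| ≤
      ρ * (Real.sqrt (∫ e, (a e - mu) ^ 2 ∂P) * Real.sqrt (∫ e, (b e - mv) ^ 2 ∂P)) := by
    rw [hmu, hmv, ← mul_assoc]
    exact h1
  -- Step 4: combine
  have hsq_su : ∫ e, su e ^ 2 ∂P = ∫ e, ∫ f, (u (e, f) - ∫ f', u (e, f') ∂Q) ^ 2 ∂Q ∂P :=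
    integral_congr_ae (ae_of_all _ fun e => Real.sq_sqrt (sectionVar_nonneg e))
  have hsq_sv : ∫ e, sv e ^ 2 ∂P = ∫ e, ∫ f, (v (e, f) - ∫ f', v (e, f') ∂Q) ^ 2 ∂Q ∂P :=
    integral_congr_ae (ae_of_all _ fun e => Real.sq_sqrt (sectionVar_nonneg e))
  have hvar_u : ∫ p, (u p - mu) ^ 2 ∂(P.prod Q) = (∫ e, su e ^ 2 ∂P) + ∫ e, (a e - mu) ^ 2 ∂P := by
    rw [hsq_su]; exact integral_prod_sub_sq hu hMu mu
  have hvar_v : ∫ p, (v p - mv) ^ 2 ∂(P.prod Q) = (∫ e, sv e ^ 2 ∂P) + ∫ e, (b e - mv) ^ 2 ∂P := by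
    rw [hsq_sv]; exact integral_prod_sub_sq hv hMv mv
  set x := Real.sqrt (∫ e, su e ^ 2 ∂P) with hx
  set y := Real.sqrt (∫ e, sv e ^ 2 ∂P) with hy
  set z := Real.sqrt (∫ e, (a e - mu) ^ 2 ∂P) with hz
  set w := Real.sqrt (∫ e, (b e - mv) ^ 2 ∂P) with hw
  have hx2 : x ^ 2 = ∫ e, su e ^ 2 ∂P := Real.sq_sqrt (integral_nonneg fun e => sq_nonneg _)
  have hy2 : y ^ 2 = ∫ e, sv e ^ 2 ∂P := Real.sq_sqrt (integral_nonneg fun e => sq_nonneg _)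
  have hz2 : z ^ 2 = ∫ e, (a e - mu) ^ 2 ∂P := Real.sq_sqrt (integral_nonneg fun e => sq_nonneg _)
  have hw2 : w ^ 2 = ∫ e, (b e - mv) ^ 2 ∂P := Real.sq_sqrt (integral_nonneg fun e => sq_nonneg _)
  calc |(∫ p, u p * v p ∂(P.prod Q)) - mu * mv|
      = |((∫ e, ∫ f, u (e, f) * v (e, f) ∂Q ∂P) - ∫ e, a e * b e ∂P) + ((∫ e, a e * b e ∂P) - mu * mv)| := by
        rw [hF]; ring_nf
    _ ≤ |(∫ e, ∫ f, u (e, f) * v (e, f) ∂Q ∂P) - ∫ e, a e * b e ∂P| + |(∫ e, a e * b e ∂P) - mu * mv| :=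
        abs_add_le _ _
    _ ≤ ρ * (x * y) + ρ * (z * w) := add_le_add hstep2 hstep3
    _ = ρ * (x * y + z * w) := by ring
    _ ≤ ρ * (Real.sqrt (x ^ 2 + z ^ 2) * Real.sqrt (y ^ 2 + w ^ 2)) :=
        mul_le_mul_of_nonneg_left (cs2 x y z w) hρ
    _ = ρ * Real.sqrt (∫ p, (u p - mu) ^ 2 ∂(P.prod Q)) * Real.sqrt (∫ p, (v p - mv) ^ 2 ∂(P.prod Q)) := by
        rw [hvar_u, hvar_v, hx2, hy2, hz2, hw2, mul_assoc]

end TwoBlock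

end Summit.QuantumFields.YangMills.Cruxes.IR.ShellMaxCorr.Tensorisation

end
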